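import Literature.MathematicalPhysics.QuantumFieldTheory.Balaban1983to89.B9Thm313WholeHolder
import Literature.MathematicalPhysics.QuantumFieldTheory.Balaban1983to89.B9Thm312WholeBlocksRel

/-!
# `Balaban1983to89.B9Thm313WholeInput` — [B9] Theorem 3.13 (p. 426): the INPUT-HÖLDER lines (3.44), (3.45) of 𝔊 = 𝔓G₁ at one member and one
# configuration, by (3.153) with the right factor ∇*_U read from the input Hölder classes — letters of printed shape for the (3.152)–(3.153)
# pieces through a W-Hölder class, r1's right resolvent form for the G₁-entries, and `B9Thm313Whole.hasMaj_frakG_classes`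

T. Bałaban, *Propagators for lattice gauge theories in a background field*, Commun. Math. Phys. **99** (1985) 389–434
[`Balaban1985BackgroundPropagators`, "B9"]; [4] = T. Bałaban, *Propagators and renormalization transformations for lattice
gauge theories. II*, Commun. Math. Phys. **96** (1984) 223–250 [`Balaban1984PropagatorsII`].

statement-level skeleton of published theorems with citation tags; proofs where landed; nothing here is a claim about the
Yang–Mills mass gap

THE PRINTED LOCI.  p. 426: *"𝔊 = 𝔓G₁ (3.153) … The formulas (3.147), (3.153) permit us to reduce properties of the operators 𝔓, 𝔊 to the
corresponding properties of the operators G′, (Q′G′²Q′*)⁻¹, G₁, (QG₁Q*)⁻¹."*; (3.152): *"RD*G₁ = RG′D*"*; (3.44)–(3.45) p. 398: *"|(∇_UG∇*_Uμ)(b)| ≦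
B′₀(ε)e^{−δ₀d(y,y′)}(‖μ‖_ε + |μ|) … ‖ζ∇_UG∇*_Uμ‖_β ≦ B′₀(ε,β)(Lʲη)^{−β}(…)e^{−δ₀d(y,y′)}(‖μ‖_{β+ε} + |μ|)"*, 0 < ε ≦ 1, 0 ≦ β < 1.

WHAT THIS FILE DOES (one member, one U; everything generic over the `Ops` ∕ `HolderProbes` SIGNATURES).
* §1 `Letters313I 𝔬 𝔭 R₀ H₀ hlen bHY bHW Br θv Bd Bd2 δ₃ δK U` (Prop structure, printed shape, NOTHING ASSERTED): through an ε-indexed W-HÖLDER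
  class `bHW ε` — `rgd ε` (RD*G₁∇*_U = RG′D*∇*_U from the input class `bHY ε` to `bHW ε`: (3.152) + Theorem 3.1 (3.45)-type for G′ + (3.49)),
  `dgDv ε` ∕ `pdgDv ε β` (the (3.44) ∕ (3.45)-type entries of G₀ with the gauge-mode derivative D of [4] (2.26) in place of ∇*_U, read from
  `bHW ε` ∕ `bHW (β+ε)`), `tDv ε` (the perturbation step (Δ′_π + Δ⁽²⁾_π)G₀D out of `bHW ε`, the shape of `StepH.tD1`), and the two structural
  facts `domY`, `locY` (the input Hölder norms dominate the block sup norm and localise in the block).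
* §2 `hasMaj_of_dom` (a majorant survives passing to a dominating source norm); ★ `GG_input_of_pieces` — (3.153) with a left factor E and the
  right factor ∇*_U (`B9Thm313WholeHolder.E_GG_F_eq`) composed by `hasMaj_frakG_classes` from the input class: the E-dependent pieces
  EG₁∇*, EG₁D, EG₁Q* are hypotheses, the E-independent ones (RD*G₁∇* letter, C₁ = `Letters313.c1_1`, QG₁∇* from the proved sup entry
  G₁∇*_U `B9Thm312WholeLeaf.entry2_of_step` + `q1` + domination) are built inside.
* §3 ★ `GG_input44_of_letters` ((3.44) of 𝔊: E = ∇_U; pieces by r06∕r1's right form `B9Thm312WholeHolder.input44_of_step` twice and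
  `B9Thm313WholeLeft.hasMaj_left_right` + the scale transfer (2.60)); ★ `GG_input45_of_letters` ((3.45): E = Φ^Y_β∘∇_U; pieces by
  `input45_of_step` twice, `probe43L_cNormR`, `B9Thm313WholeHolder.hasMaj_left_rightR` + the transfer); constants `constI44`, `constI45`.

HONEST SCOPE.  Nothing of [B9] or [4] is asserted: Theorem 3.3 for G₀, the steps, the letters, the identities and (2.60)–(2.61) are HYPOTHESES of
printed ∕ definitional shape (located gap G-B9-16); the content is bookkeeping, kernel-checked.  NOT a node discharge, NOT summit progress; one
finite lattice at a time; nothing continuum, nothing about the mass gap.  Cell `pub-ymgap` (HUMAN RULING D-0062), Track A node N06 [B9],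
N06-ASSIGNMENT v1 row 21 (bundle F7), seat `pub-ymgap-dag-n06-l` (g4), 2026-08-27.
-/

namespace Literature.MathematicalPhysics.QuantumFieldTheory.Balaban1983to89.B9Thm313WholeInput

open Literature.MathematicalPhysics.QuantumFieldTheory.Balaban1983to89
open Finset B6RandomWalk B6RandomWalkHom B9Thm34Ext B9Thm37GlueCor36 B11SectG B9SectDSup
open B9Thm37AllNorms B9Thm37AllNormsInstances B9Thm312Whole B9Thm312WholeLeaf B9Thm312WholeLeft B9Thm313Whole B9Thm313WholeLeft
open B9RWSums343Holder B9Ineq347 B9Thm312WholeClasses B9Thm312WholeHolder B9Thm312WholeHHolder B9Thm313WholeHolder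

noncomputable section

section OneMember

variable {g : B9.Geometry} {B : B9.Backgrounds} {X Y Z W PX PY : Type}
variable [Fintype X] [Fintype Y] [Fintype Z] [Fintype W] [Fintype PX] [Fintype PY] [Fintype g.Site]
variable {R₀ : ℝ} {H₀ : Prop}

/-! ## §1 The letters of (3.152)–(3.153) read from the input Hölder classes (printed shape; nothing asserted) -/

/-- **THE INPUT-CLASS LETTERS OF THEOREM 3.13's REDUCTION AT U** (p. 426: *"The formulas (3.147), (3.153) permit us to reduce properties of the
operators 𝔓, 𝔊 to the corresponding properties of the operators G′, (Q′G′²Q′*)⁻¹, G₁, (QG₁Q*)⁻¹"*), through an ε-indexed W-HÖLDER class `bHW ε`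
(the twice-differentiated propagators are read from Hölder inputs, as in (3.44)–(3.45)): `rgd ε` — RD*G₁∇*_U = RG′D*∇*_U : `bHY ε → bHW ε`
((3.152); Theorem 3.1 for G′ and (3.49) for R); `dgDv ε` — ∇_UG₀D : `bHW ε →` block sup, constant B_d(ε), and `pdgDv ε β` — Φ^Y_β∘∇_UG₀D :
`bHW (β+ε) →` probe blocks, B_d2(ε,β)(Lʲη)^{−β} (the (3.44) ∕ (3.45)-type entries of Theorem 3.3's G₀ with the gauge-mode derivative D of DRD*,
[4] (2.26)); `tDv ε` — the perturbation step (Δ′_π + Δ⁽²⁾_π)G₀D : `bHW ε → 𝔠^{(1)}`, θ_v·e^{−δ_K d} (p. 422, the shape of `StepH.tD1`); `domY`,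
`locY` — the input norms ‖μ‖_ε + |μ| dominate |μ| on the block and are block-localised ((3.41), [4] (2.51)–(2.52)).  NOTHING ASSERTED: these are
the instance's. [cite: Balaban1985BackgroundPropagators, Thm 3.13 p.426 + (3.152)–(3.153) p.426 + (3.44)–(3.45) p.398 + (3.41) p.397 + (3.130)–(3.131) pp.421–422; Balaban1984PropagatorsII, (2.26) p.228 + (2.51)–(2.52) p.232] -/
structure Letters313I (𝔬 : Ops g B X Y Z W) (𝔭 : HolderProbes g B X Y PX PY) (R₀ : ℝ) (H₀ : Prop)
    (hlen : ∀ y : g.Site, 0 ≤ g.len y) (bHY : ℝ → BlockNorm (toB6 g R₀ H₀) (Y → ℝ))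
    (bHW : ℝ → BlockNorm (toB6 g R₀ H₀) (W → ℝ)) (Br θv : ℝ) (Bd : ℝ → ℝ) (Bd2 : ℝ → ℝ → ℝ) (δ₃ δK : ℝ)
    (U : B.Cfg) : Prop where
  rgd : ∀ ε : ℝ, 0 < ε → HasMaj (bHY ε) (bHW ε) (𝔬.R U ∘ₗ 𝔬.Dvstar U ∘ₗ 𝔬.G1 U ∘ₗ 𝔬.Dstar U)
    (fun a b => Br * Real.exp (-(δ₃ * g.dist a b)))
  dgDv : ∀ ε : ℝ, 0 < ε → ε ≤ 1 → HasMaj (bHW ε) (BlockNorm.ofBlocks (toB6 g R₀ H₀) 𝔬.blkY)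
    (𝔬.D U ∘ₗ (𝔬.G0 U ∘ₗ 𝔬.Dv U)) (fun (a b : g.Site) => Bd ε * Real.exp (-(δ₃ * g.dist a b)))
  pdgDv : ∀ ε β : ℝ, 0 < ε → ε ≤ 1 → 0 ≤ β → β < 1 → HasMaj (bHW (β + ε)) (BlockNorm.ofBlocks (toB6 g R₀ H₀) 𝔭.blkPY)
    ((𝔭.ΦY U β ∘ₗ 𝔬.D U) ∘ₗ (𝔬.G0 U ∘ₗ 𝔬.Dv U))
    (fun (a b : g.Site) => Bd2 ε β * g.len a ^ (-β) * Real.exp (-(δ₃ * g.dist a b)))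
  tDv : ∀ ε : ℝ, 0 < ε → HasMaj (bHW ε) (cNormR R₀ H₀ 𝔬.blk hlen 1) ((𝔬.Tpi U + 𝔬.T2 U) ∘ₗ (𝔬.G0 U ∘ₗ 𝔬.Dv U))
    (fun a b => θv * Real.exp (-(δK * g.dist a b)))
  domY : ∀ ε : ℝ, 0 < ε → ∀ (y : g.Site) (μ : Y → ℝ), (BlockNorm.ofBlocks (toB6 g R₀ H₀) 𝔬.blkY).loc y μ ≤ (bHY ε).loc y μ
  locY : ∀ ε : ℝ, 0 < ε → ∀ (y : g.Site) (μ : Y → ℝ),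
    (bHY ε).IsLoc y μ → (BlockNorm.ofBlocks (toB6 g R₀ H₀) 𝔬.blkY).IsLoc y μ

/-! ## §2 (3.153) with a left factor, the right factor ∇*_U read from an input class -/

omit [Fintype X] [Fintype Y] [Fintype Z] [Fintype W] [Fintype PX] [Fintype PY] [Fintype g.Site] in
/-- A majorant with non-negative kernel survives replacing the source norm by a dominating, equally localised one.
[cite: Balaban1984PropagatorsII, (2.51)–(2.52) p.232 (bookkeeping)] -/
theorem hasMaj_of_dom {G6 : B6.Geometry} {F₁ F₂ : Type} [AddCommGroup F₁] [Module ℝ F₁] [AddCommGroup F₂] [Module ℝ F₂]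
    {b₁ b₁' : BlockNorm G6 F₁} {b₂ : BlockNorm G6 F₂} {T : F₁ →ₗ[ℝ] F₂} {K : G6.Site → G6.Site → ℝ}
    (hle : ∀ y μ, b₁.loc y μ ≤ b₁'.loc y μ) (hloc : ∀ y μ, b₁'.IsLoc y μ → b₁.IsLoc y μ) (hK : ∀ a b, 0 ≤ K a b)
    (h : HasMaj b₁ b₂ T K) : HasMaj b₁' b₂ T K :=
  fun y' μ hμ y => (h y' μ (hloc y' μ hμ) y).trans (mul_le_mul_of_nonneg_left (hle y' μ) (hK y y'))

omit [Fintype Z] [Fintype W] [Fintype PX] [Fintype PY] in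
/-- **THE (3.44)-TYPE MEMBER OF A ∈ {G, G₁} WITH A GENERAL RIGHT LETTER F** (r06∕r1's right form, `B9Thm312WholeHolder.input44_of_step` with the
domain of F decoupled from the range of ∇_U): ∇_UAF = ∇_UG₀F + (∇_UA)(TG₀F) from A = G₀ + ATG₀; the first term is the letter `h44` (out of the input
class `bHε` on V), the second ONE composition of the proved left entry ∇_UA (transferred by (2.60) to 𝔠^{(1)} → 𝔠_Y^{(0)}) with the step TG₀F out
of `bHε` (`htD`).  Used with F = D, the gauge-mode derivative. [cite: Balaban1985BackgroundPropagators, Thm 3.12 p.423 + (3.44) p.398 + (3.130) p.421; Balaban1984PropagatorsII, Lemma 2.1 p.234] -/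
theorem input44_of_stepV (hG : GeoOK g) {V : Type} {blk : X → g.Site} {blkY : Y → g.Site}
    {bHε : BlockNorm (toB6 g R₀ H₀) (V → ℝ)} {G0 T A : Module.End ℝ (X → ℝ)} {Dop : (X → ℝ) →ₗ[ℝ] (Y → ℝ)}
    {Ds : (V → ℝ) →ₗ[ℝ] (X → ℝ)} {θH Bi C₁ δ₀ δK ρ ρ₂ α Λ σ c : ℝ} (hrow : RowSum (toB6 g R₀ H₀) σ c)
    (hθH : 0 ≤ θH) (hBi : 0 ≤ Bi) (hC₁ : 0 ≤ C₁) (hΛ : 0 ≤ Λ) (hρ₂ : 0 ≤ ρ₂) (hρ₂σ : ρ₂ + σ ≤ (1 - α) * ρ)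
    (hρ₂K : ρ₂ ≤ δK) (hρ₂δ : ρ₂ ≤ δ₀) (hST : ScaleTransfer g ρ α Λ (fun y => g.len y ^ (1 : ℝ)))
    (h1 : HasMajorantHom (g := toB6 g R₀ H₀) blk blkY (Dop ∘ₗ A) (fun a b => C₁ * g.len a * Real.exp (-(ρ * g.dist a b))))
    (h44 : HasMaj bHε (BlockNorm.ofBlocks (toB6 g R₀ H₀) blkY) (Dop ∘ₗ (G0 ∘ₗ Ds))
      (fun (a b : g.Site) => Bi * Real.exp (-(δ₀ * g.dist a b))))
    (htD : HasMaj bHε (cNormR R₀ H₀ blk hG.lenle 1) (T ∘ₗ (G0 ∘ₗ Ds)) (fun a b => θH * Real.exp (-(δK * g.dist a b))))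
    (hfixR : A = G0 + A ∘ₗ T ∘ₗ G0) :
    HasMaj bHε (BlockNorm.ofBlocks (toB6 g R₀ H₀) blkY) (Dop ∘ₗ (A ∘ₗ Ds))
      (fun (a b : g.Site) => (Bi + C₁ * Λ * θH * c) * Real.exp (-(ρ₂ * g.dist a b))) := by
  have htri : Triangle254 (toB6 g R₀ H₀) := fun a b c => hG.tri a b c
  have hc : 0 ≤ c ∨ IsEmpty g.Site := by
    by_cases hne : Nonempty g.Site
    · exact Or.inl (hrow.nonneg hne.some)
    · exact Or.inr (not_nonempty_iff.mp hne)
  rcases hc with hc | hemp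
  swap
  · intro y' μ hμ y
    exact (hemp.false y).elim
  have hE := hasMaj_entry1_transfer hG hC₁ hST h1
  have h2 : HasMaj bHε (cNormR R₀ H₀ blkY hG.lenle 0) ((Dop ∘ₗ A) ∘ₗ (T ∘ₗ (G0 ∘ₗ Ds)))
      (fun a b => (cNormR R₀ H₀ blk hG.lenle 1 (X := X)).κ * (C₁ * Λ) * θH * c * Real.exp (-(ρ₂ * g.dist a b))) :=
    hasMaj_comp_exp htri hG.dnn hrow (mul_nonneg hC₁ hΛ) hθH hρ₂ hρ₂K hρ₂σ hE htD
  simp only [cNormR_κ, one_mul] at h2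
  have hsum := (h44.of_rate_le hG.dnn hBi hρ₂δ).add (hasMaj_of_out_zero h2)
  rw [← comp_fix_twoSided_right Dop Ds hfixR] at hsum
  exact hsum.mono fun a b => le_of_eq (by simp only [toB6_dist]; ring)

omit [Fintype PX] [Fintype PY] in
/-- ★ **(3.153) WITH A LEFT FACTOR E, THE RIGHT FACTOR ∇\*_U READ FROM AN INPUT CLASS** `bA` (dominating the block sup norm): E𝔊∇\* = EG₁∇\* −
(EG₁D)(RD\*G₁∇\*) − (EG₁Q*)(C₁QG₁∇\*) (`E_GG_F_eq`), composed by `hasMaj_frakG_classes` with the classes bA → bC (output), `bP` (the W-Hölder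
class of RD\*G₁∇\*), Z^{(1)} = `cNorm … 1` and 𝔠_Z^{(1)} = `cNormR … 1` for C₁ (`Letters313.c1_1`): the E-dependent pieces EG₁∇\* (K₄₄), EG₁D
(K_D), EG₁Q* (K_Q, out of 𝔠_Z^{(1)}) at the common rate ρ₂ are hypotheses; QG₁∇\* is built from the proved sup entry G₁∇\*_U
(`entry2_of_step` at the rate r: Theorem 3.3 (3.42)₃ for G₀ + the step on 𝔠⁽¹⁾), the domination `bA ≧ |·|` and the local letter Q (`q1`);
provisos ρ₄ + 2σ ≦ ρ₂ ≦ r, ρ₂ + σ ≦ δ₃, r ≦ δ₀, r + σ ≦ δ_K, θc < 1.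
[cite: Balaban1985BackgroundPropagators, Thm 3.13 p.426 + (3.153) p.426 + (3.44)–(3.45) p.398 + (3.132) p.422; Balaban1984PropagatorsII, Lemma 2.1 (2.61) p.234] -/
theorem GG_input_of_pieces (hG : GeoOK g) {𝔬 : Ops g B X Y Z W} {U : B.Cfg} {P : Type}
    {bA : BlockNorm (toB6 g R₀ H₀) (Y → ℝ)} {bP : BlockNorm (toB6 g R₀ H₀) (W → ℝ)} {bC : BlockNorm (toB6 g R₀ H₀) (P → ℝ)}
    {E : (X → ℝ) →ₗ[ℝ] (P → ℝ)} {θ B₀ B₃ Br K44 KD KQ δ₀ δ₃ δK r ρ₂ ρ₄ σ c : ℝ}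
    (hrow : RowSum (toB6 g R₀ H₀) σ c) (hc : 0 ≤ c) (hθ : 0 ≤ θ) (hB₀ : 0 ≤ B₀) (hB₃ : 0 ≤ B₃) (hBr : 0 ≤ Br) (hK44 : 0 ≤ K44)
    (hKD : 0 ≤ KD) (hKQ : 0 ≤ KQ) (hσ : 0 ≤ σ) (hρ₄ : 0 ≤ ρ₄) (hρ₄₂ : ρ₄ + 2 * σ ≤ ρ₂) (hρ₂r : ρ₂ ≤ r) (hρ₂₃ : ρ₂ + σ ≤ δ₃)
    (hr : 0 ≤ r) (hr0 : r ≤ δ₀) (hrK : r + σ ≤ δK) (hq : θ * c < 1)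
    (hK1 : HasMaj (cNorm R₀ H₀ 𝔬.blk hG.lenle 1) (cNorm R₀ H₀ 𝔬.blk hG.lenle 1) (𝔬.G0 U ∘ₗ (𝔬.Tpi U + 𝔬.T2 U))
      (fun a b => θ * Real.exp (-(δK * g.dist a b))))
    (he2 : HasMajorantHom (g := toB6 g R₀ H₀) 𝔬.blkY 𝔬.blk (𝔬.G0 U ∘ₗ 𝔬.Dstar U)
      (fun (a b : g.Site) => B₀ * g.len a * Real.exp (-(δ₀ * g.dist a b))))
    (hL : Letters313 𝔬 R₀ H₀ hG B₃ δ₃ U) (hI : Identities 𝔬 U)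
    (hdom : ∀ (y : g.Site) (μ : Y → ℝ), (BlockNorm.ofBlocks (toB6 g R₀ H₀) 𝔬.blkY).loc y μ ≤ bA.loc y μ)
    (hloc : ∀ (y : g.Site) (μ : Y → ℝ), bA.IsLoc y μ → (BlockNorm.ofBlocks (toB6 g R₀ H₀) 𝔬.blkY).IsLoc y μ)
    (hRG : HasMaj bA bP (𝔬.R U ∘ₗ 𝔬.Dvstar U ∘ₗ 𝔬.G1 U ∘ₗ 𝔬.Dstar U) (fun a b => Br * Real.exp (-(δ₃ * g.dist a b))))
    (hGop : HasMaj bA bC (E ∘ₗ (𝔬.G1 U ∘ₗ 𝔬.Dstar U)) (fun a b => K44 * Real.exp (-(ρ₂ * g.dist a b))))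
    (hGD : HasMaj bP bC (E ∘ₗ (𝔬.G1 U ∘ₗ 𝔬.Dv U)) (fun a b => KD * Real.exp (-(ρ₂ * g.dist a b))))
    (hGQ : HasMaj (cNormR R₀ H₀ 𝔬.blkZ hG.lenle 1) bC (E ∘ₗ 𝔬.G1 U ∘ₗ 𝔬.Qstar U)
      (fun a b => KQ * Real.exp (-(ρ₂ * g.dist a b)))) :
    HasMaj bA bC (E ∘ₗ (𝔬.GG U ∘ₗ 𝔬.Dstar U))
      (fun a b => (K44 + bP.κ * KD * Br * c + KQ * (B₃ * (B₃ * (B₀ * (1 - θ * c)⁻¹) * c) * c) * c) *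
        Real.exp (-(ρ₄ * g.dist a b))) := by
  have htri : Triangle254 (toB6 g R₀ H₀) := fun a b c => hG.tri a b c
  have hfix1 := fix_of_inverses hI.invG0' hI.invG1
  have hq1 : 0 ≤ (1 - θ * c)⁻¹ := inv_nonneg.mpr (by linarith)
  have hA₁ : 0 ≤ B₀ * (1 - θ * c)⁻¹ := mul_nonneg hB₀ hq1
  have hρ₂0 : 0 ≤ ρ₂ := by linarith
  have hρ₂₃' : ρ₂ ≤ δ₃ := by linarith
  -- QG₁∇* : bA → Z^{(1)} — G₁∇* from the proved sup entry, the domination, the local letter Q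
  have hm2 := entry2_of_step hG hrow hθ hB₀ hr hr0 hrK hK1 he2 hfix1 hq
  have h20 : HasMaj (BlockNorm.ofBlocks (toB6 g R₀ H₀) 𝔬.blkY) (BlockNorm.ofBlocks (toB6 g R₀ H₀) 𝔬.blk) (𝔬.G1 U ∘ₗ 𝔬.Dstar U)
      (fun a b => B₀ * (1 - θ * c)⁻¹ * g.len a * Real.exp (-(r * g.dist a b))) :=
    hasMaj_of_hasMajorantHom (G := toB6 g R₀ H₀) 𝔬.blkY 𝔬.blk
      (fun a b => mul_nonneg (mul_nonneg hA₁ (hG.lenle a)) (Real.exp_nonneg _)) hm2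
  have h2c : HasMaj (cNorm R₀ H₀ 𝔬.blkY hG.lenle 0) (cNorm R₀ H₀ 𝔬.blk hG.lenle 1) (𝔬.G1 U ∘ₗ 𝔬.Dstar U)
      (fun a b => B₀ * (1 - θ * c)⁻¹ * Real.exp (-(r * g.dist a b))) := by
    refine (hasMaj_cNorm_of_hasMaj hG 1 0 h20).mono fun y y' => le_of_eq ?_
    have hy : g.len y ≠ 0 := (hG.lenpos y).ne'
    simp only [wt, pow_zero, pow_one, mul_one]
    rw [mul_assoc (B₀ * (1 - θ * c)⁻¹), mul_comm (g.len y), ← mul_assoc (B₀ * (1 - θ * c)⁻¹), mul_assoc,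
      mul_inv_cancel₀ hy, mul_one]
  have h2o : HasMaj (BlockNorm.ofBlocks (toB6 g R₀ H₀) 𝔬.blkY) (cNorm R₀ H₀ 𝔬.blk hG.lenle 1) (𝔬.G1 U ∘ₗ 𝔬.Dstar U)
      (fun a b => B₀ * (1 - θ * c)⁻¹ * Real.exp (-(r * g.dist a b))) := by
    have h := hasMaj_toR_src hG h2c
    simp only [Nat.cast_zero, neg_zero] at h
    exact hasMaj_of_in_zero h
  have h2A : HasMaj bA (cNorm R₀ H₀ 𝔬.blk hG.lenle 1) (𝔬.G1 U ∘ₗ 𝔬.Dstar U)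
      (fun a b => B₀ * (1 - θ * c)⁻¹ * Real.exp (-(r * g.dist a b))) :=
    hasMaj_of_dom hdom hloc (fun a b => mul_nonneg hA₁ (Real.exp_nonneg _)) h2o
  have hQG : HasMaj bA (cNorm R₀ H₀ 𝔬.blkZ hG.lenle 1) (𝔬.Q U ∘ₗ (𝔬.G1 U ∘ₗ 𝔬.Dstar U))
      (fun a b => (cNorm R₀ H₀ 𝔬.blk hG.lenle 1 (X := X)).κ * B₃ * (B₀ * (1 - θ * c)⁻¹) * c *
        Real.exp (-(ρ₂ * g.dist a b))) :=
    hasMaj_comp_exp htri hG.dnn hrow hB₃ hA₁ hρ₂0 hρ₂r hρ₂₃ hL.q1 h2A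
  simp only [cNorm_κ, one_mul] at hQG
  -- C₁ : Z^{(1)} → 𝔠_Z^{(1)}
  have hC : HasMaj (cNorm R₀ H₀ 𝔬.blkZ hG.lenle 1) (cNormR R₀ H₀ 𝔬.blkZ hG.lenle 1) (𝔬.C1 U)
      (fun a b => B₃ * Real.exp (-(δ₃ * g.dist a b))) := hasMaj_len_tgt hG hL.c1_1
  have hBQ0 : 0 ≤ B₃ * (B₀ * (1 - θ * c)⁻¹) * c := mul_nonneg (mul_nonneg hB₃ hA₁) hc
  -- (3.153) composed
  have hfr := hasMaj_frakG_classes htri hG.dnn hrow hK44 hKD hBr hKQ hB₃ hBQ0 hρ₄ hσ hρ₄₂ hGop hGD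
    (hRG.of_rate_le hG.dnn hBr hρ₂₃') hGQ (hC.of_rate_le hG.dnn hB₃ hρ₂₃') hQG
  have hGG := hfr.congr (T' := E ∘ₗ (𝔬.GG U ∘ₗ 𝔬.Dstar U)) fun μ => by rw [E_GG_F_eq hI E (𝔬.Dstar U)]
  refine hGG.mono fun a b => le_of_eq ?_
  simp only [cNorm_κ, cNormR_κ, one_mul, toB6_dist]

/-! ## §3 The two input-Hölder lines of 𝔊 = 𝔓G₁ -/

/-- The constant of 𝔊's (3.44) line as the reduction delivers it (q = (1 − θc)⁻¹, C_L = B₀ + θ′B₀qc the ∇_UG₁ constant): (B_i + C_LΛθ_Hc) +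
κ_W(B_d + C_LΛθ_vc)B_rc + (B₃ + θ′B₃qc)Λ·(B₃(B₃B₀qc)c)c. [cite: Balaban1985BackgroundPropagators, Thm 3.13 p.426 (bookkeeping)] -/
def constI44 (θ θ' θH θv B₀ B₃ Bi Bd Br Λ κ c : ℝ) : ℝ :=
  (Bi + (B₀ + θ' * (B₀ * (1 - θ * c)⁻¹) * c) * Λ * θH * c) +
    κ * (Bd + (B₀ + θ' * (B₀ * (1 - θ * c)⁻¹) * c) * Λ * θv * c) * Br * c +
    (B₃ + θ' * (B₃ * (1 - θ * c)⁻¹) * c) * Λ * (B₃ * (B₃ * (B₀ * (1 - θ * c)⁻¹) * c) * c) * c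

/-- The constant of 𝔊's (3.45) line (q = (1 − θc)⁻¹, C_h = B_h + θ_HB₀qc the probe constant of Φ^Y_β∇_UG₁): (B_i2 + C_hΛθ_Hc) + κ_W(B_d2 +
C_hΛθ_vc)B_rc + (B_q + θ_HB₃qc)Λ·(B₃(B₃B₀qc)c)c. [cite: Balaban1985BackgroundPropagators, Thm 3.13 p.426 (bookkeeping)] -/
def constI45 (θ θH θv B₀ B₃ Bh Bi2 Bd2 Bq Br Λ κ c : ℝ) : ℝ :=
  (Bi2 + (Bh + θH * (B₀ * (1 - θ * c)⁻¹) * c) * Λ * θH * c) +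
    κ * (Bd2 + (Bh + θH * (B₀ * (1 - θ * c)⁻¹) * c) * Λ * θv * c) * Br * c +
    (Bq + θH * (B₃ * (1 - θ * c)⁻¹) * c) * Λ * (B₃ * (B₃ * (B₀ * (1 - θ * c)⁻¹) * c) * c) * c

omit [Fintype PX] in
/-- ★ **(3.44) FOR 𝔊 = 𝔓G₁, PRINTED SHAPE** — ∇_U𝔊∇\*_U read from the input Hölder class `bHY ε` into the block sup norm: |(∇_U𝔊∇\*_Uμ)(b)| ≦
K·e^{−ρ₄d(y,y′)}(‖μ‖_ε + |μ|) for b ∈ Δ(y), supp μ ⊂ Δ̃(y′) (the input `h44` of n06-k's `lines3445_of_hasMaj_rel`), K = `constI44 … (bHW ε).κ c`.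
Route: (3.153) with E = ∇_U (`GG_input_of_pieces`); ∇_UG₁∇\*_U and ∇_UG₁D by r1's right form (`input44_of_step` from Theorem 3.3 (3.44) for G₀ ∕ the
letter `dgDv`, the steps `tD1` ∕ `tDv`, the proved ∇_UG₁ sup entry transferred by (2.60)); ∇_UG₁Q* by `hasMaj_left_right` (letters `dgQs`, `gQs2`)
transferred by (2.60) to Z^{(1)} → 𝔠_Y^{(0)}.  Provisos: ρ₄ + 3σ ≦ (1 − α)r, r ≦ δ₀, r ≦ δ₃, r + σ ≦ δ_K, θc < 1.
[cite: Balaban1985BackgroundPropagators, Thm 3.13 p.426 + (3.153) p.426 + (3.44) p.398 + Thm 3.12 p.423 + p.398 (remark after (3.47)); Balaban1984PropagatorsII, Lemma 2.1 (2.60)–(2.61) p.234] -/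
theorem GG_input44_of_letters (hG : GeoOK g) (𝔭 : HolderProbes g B X Y PX PY) {𝔬 : Ops g B X Y Z W} {U : B.Cfg}
    {bHY : ℝ → BlockNorm (toB6 g R₀ H₀) (Y → ℝ)} {bHW : ℝ → BlockNorm (toB6 g R₀ H₀) (W → ℝ)} {bH : BlockNorm (toB6 g R₀ H₀) (W → ℝ)}
    {Bd : ℝ → ℝ} {Bd2 : ℝ → ℝ → ℝ} {θ θ' θH θv B₀ B₃ Bi Br δ₀ δ₃ δK r ρ₄ α Λ σ c ε : ℝ} (hrow : RowSum (toB6 g R₀ H₀) σ c)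
    (hc : 0 ≤ c) (hθ : 0 ≤ θ) (hθ' : 0 ≤ θ') (hθH : 0 ≤ θH) (hθv : 0 ≤ θv) (hB₀ : 0 ≤ B₀) (hB₃ : 0 ≤ B₃) (hBi : 0 ≤ Bi)
    (hBd : 0 ≤ Bd ε) (hBr : 0 ≤ Br) (hΛ : 0 ≤ Λ) (hα : 0 ≤ α) (hσ : 0 ≤ σ) (hε0 : 0 < ε) (hε1 : ε ≤ 1) (hρ₄ : 0 ≤ ρ₄)
    (hρ₄r : ρ₄ + 3 * σ ≤ (1 - α) * r) (hr : 0 ≤ r) (hr0 : r ≤ δ₀) (hr₃ : r ≤ δ₃) (hrK : r + σ ≤ δK) (hq : θ * c < 1)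
    (hST : ScaleTransfer g r α Λ (fun y => g.len y ^ (1 : ℝ)))
    (hK1 : HasMaj (cNorm R₀ H₀ 𝔬.blk hG.lenle 1) (cNorm R₀ H₀ 𝔬.blk hG.lenle 1) (𝔬.G0 U ∘ₗ (𝔬.Tpi U + 𝔬.T2 U))
      (fun a b => θ * Real.exp (-(δK * g.dist a b))))
    (hK2 : HasMaj (cNorm R₀ H₀ 𝔬.blk hG.lenle 2) (cNorm R₀ H₀ 𝔬.blk hG.lenle 2) (𝔬.G0 U ∘ₗ (𝔬.Tpi U + 𝔬.T2 U))
      (fun a b => θ * Real.exp (-(δK * g.dist a b))))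
    (he0 : HasMajorant (g := toB6 g R₀ H₀) 𝔬.blk (𝔬.G0 U) (fun a b => B₀ * g.len a ^ 2 * Real.exp (-(δ₀ * g.dist a b))))
    (he2 : HasMajorantHom (g := toB6 g R₀ H₀) 𝔬.blkY 𝔬.blk (𝔬.G0 U ∘ₗ 𝔬.Dstar U)
      (fun (a b : g.Site) => B₀ * g.len a * Real.exp (-(δ₀ * g.dist a b))))
    (hLS : LeftStep 𝔬 R₀ H₀ hG.lenle B₀ δ₀ θ' δK U)
    (h44 : HasMaj (bHY ε) (BlockNorm.ofBlocks (toB6 g R₀ H₀) 𝔬.blkY) (𝔬.D U ∘ₗ (𝔬.G0 U ∘ₗ 𝔬.Dstar U))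
      (fun (a b : g.Site) => Bi * Real.exp (-(δ₀ * g.dist a b))))
    (htD : HasMaj (bHY ε) (cNormR R₀ H₀ 𝔬.blk hG.lenle 1) ((𝔬.Tpi U + 𝔬.T2 U) ∘ₗ (𝔬.G0 U ∘ₗ 𝔬.Dstar U))
      (fun a b => θH * Real.exp (-(δK * g.dist a b))))
    (hL : Letters313 𝔬 R₀ H₀ hG B₃ δ₃ U) (hLD : Letters313D 𝔬 R₀ H₀ hG B₃ δ₃ bH U)
    (hLI : Letters313I 𝔬 𝔭 R₀ H₀ hG.lenle bHY bHW Br θv Bd Bd2 δ₃ δK U) (hI : Identities 𝔬 U) :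
    HasMaj (bHY ε) (BlockNorm.ofBlocks (toB6 g R₀ H₀) 𝔬.blkY) (𝔬.D U ∘ₗ (𝔬.GG U ∘ₗ 𝔬.Dstar U))
      (fun (a b : g.Site) => constI44 θ θ' θH θv B₀ B₃ Bi (Bd ε) Br Λ (bHW ε).κ c * Real.exp (-(ρ₄ * g.dist a b))) := by
  have hfix1 := fix_of_inverses hI.invG0' hI.invG1
  have hfixR := fix_right_of_inverses hI.invG0' hI.invG1
  have hq1 : 0 ≤ (1 - θ * c)⁻¹ := inv_nonneg.mpr (by linarith)
  have hA₁ : 0 ≤ B₀ * (1 - θ * c)⁻¹ := mul_nonneg hB₀ hq1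
  have hA₃ : 0 ≤ B₃ * (1 - θ * c)⁻¹ := mul_nonneg hB₃ hq1
  have hCL : 0 ≤ B₀ + θ' * (B₀ * (1 - θ * c)⁻¹) * c := add_nonneg hB₀ (mul_nonneg (mul_nonneg hθ' hA₁) hc)
  have hKQ' : 0 ≤ B₃ + θ' * (B₃ * (1 - θ * c)⁻¹) * c := add_nonneg hB₃ (mul_nonneg (mul_nonneg hθ' hA₃) hc)
  -- rates
  have h1α : (1 - α) * r ≤ r := by rw [sub_mul, one_mul]; exact sub_le_self _ (mul_nonneg hα hr)
  have hρ₂0 : 0 ≤ ρ₄ + 2 * σ := by linarith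
  have hρ₂σ : ρ₄ + 2 * σ + σ ≤ (1 - α) * r := by linarith
  have hρ₂α : ρ₄ + 2 * σ ≤ (1 - α) * r := by linarith
  have hρ₂r : ρ₄ + 2 * σ ≤ r := by linarith
  have hρ₂K : ρ₄ + 2 * σ ≤ δK := by linarith
  have hρ₂0' : ρ₄ + 2 * σ ≤ δ₀ := by linarith
  have hρ₂₃ : ρ₄ + 2 * σ ≤ δ₃ := by linarith
  have hρ₂₃σ : ρ₄ + 2 * σ + σ ≤ δ₃ := by linarith
  -- the proved sup entry ∇_UG₁ at the rate r
  have hm1 := entry1_of_stepD hG hrow hθ hθ' hB₀ hr hr0 hrK hK2 hLS.stepD1 he0 hLS.e1 hfix1 hq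
  -- ∇G₁∇* from `bHY ε` and ∇G₁D from `bHW ε` by the right form
  have hGop := input44_of_step hG hrow hθH hBi hCL hΛ hρ₂0 hρ₂σ hρ₂K hρ₂0' hST hm1 h44 htD hfixR
  have hGD := input44_of_stepV hG hrow hθv hBd hCL hΛ hρ₂0 hρ₂σ hρ₂K hρ₂₃ hST hm1 (hLI.dgDv ε hε0 hε1) (hLI.tDv ε hε0)
    hfixR
  -- ∇G₁Q* : Z⁰ → 𝔠_Y⁽¹⁾ by the left form, then (2.60): Z^{(1)} → 𝔠_Y^{(0)}
  have hGQr := hasMaj_right_of_step hG hrow hθ hB₃ hr hr₃ hrK hK2 hL.gQs2 hfix1 hq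
  have hDQ := hasMaj_left_right hG hrow hθ' hB₃ hA₃ hr hr₃ le_rfl hrK hLS.stepD1 hLD.dgQs hGQr hfix1
  have hDQR : HasMaj (cNormR R₀ H₀ 𝔬.blkZ hG.lenle 0) (cNormR R₀ H₀ 𝔬.blkY hG.lenle (-1)) (𝔬.D U ∘ₗ 𝔬.G1 U ∘ₗ 𝔬.Qstar U)
      (fun y y' => (B₃ + θ' * (B₃ * (1 - θ * c)⁻¹) * c) * Real.exp (-(r * g.dist y y'))) := by
    have h := hasMaj_toR hG hDQ
    simp only [Nat.cast_zero, neg_zero, Nat.cast_one] at h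
    exact h
  have hDQT := hasMaj_transfer hG hKQ' hST hDQR
  have e1 : (0 : ℝ) + 1 = 1 := by ring
  have e2 : (-1 : ℝ) + 1 = 0 := by ring
  rw [e1, e2] at hDQT
  have hGQ : HasMaj (cNormR R₀ H₀ 𝔬.blkZ hG.lenle 1) (BlockNorm.ofBlocks (toB6 g R₀ H₀) 𝔬.blkY) (𝔬.D U ∘ₗ 𝔬.G1 U ∘ₗ 𝔬.Qstar U)
      (fun a b => (B₃ + θ' * (B₃ * (1 - θ * c)⁻¹) * c) * Λ * Real.exp (-((ρ₄ + 2 * σ) * g.dist a b))) :=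
    hasMaj_of_out_zero (hDQT.of_rate_le hG.dnn (mul_nonneg hKQ' hΛ) hρ₂α)
  -- (3.153)
  have h := GG_input_of_pieces hG hrow hc hθ hB₀ hB₃ hBr (add_nonneg hBi (mul_nonneg (mul_nonneg (mul_nonneg hCL hΛ) hθH) hc))
    (add_nonneg hBd (mul_nonneg (mul_nonneg (mul_nonneg hCL hΛ) hθv) hc)) (mul_nonneg hKQ' hΛ) hσ hρ₄ le_rfl hρ₂r hρ₂₃σ hr hr0 hrK hq
    hK1 he2 hL hI (hLI.domY ε hε0) (hLI.locY ε hε0) (hLI.rgd ε hε0) hGop hGD hGQ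
  refine h.mono fun a b => le_of_eq ?_
  simp only [constI44]

omit [Fintype PX] in
/-- ★ **(3.45) FOR 𝔊 = 𝔓G₁, PRINTED SHAPE** — Φ^Y_β∘∇_U𝔊∇\*_U read from the input Hölder class `bHY (β+ε)` into the probe blocks:
‖ζ∇_U𝔊∇\*_Uμ‖_β-type bound K·(Lʲη)^{−β}·e^{−ρ₄d(y,y′)}(‖μ‖_{β+ε} + |μ|) (the input `h45` of n06-k's `lines3445_of_hasMaj_rel`), K = `constI45 … (bHW (β+ε)).κ c`.
Route: (3.153) with E = Φ^Y_β∘∇_U in the real class 𝔠_P^{(β)} (`GG_input_of_pieces`); Φ^Y_β∇_UG₁∇\*_U and Φ^Y_β∇_UG₁D by the right form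
(`input45_of_step` from Theorem 3.3 (3.45) for G₀ ∕ the letter `pdgDv`, the steps `tD1` ∕ `tDv`, the proved probe entry `probe43L_cNormR`);
Φ^Y_β∇_UG₁Q* by `hasMaj_left_rightR` (letters `LettersHH.pQ`, `gQs2`, the probe step `pY1`) transferred by (2.60).  Provisos as for (3.44).
[cite: Balaban1985BackgroundPropagators, Thm 3.13 p.426 + (3.153) p.426 + (3.45) p.398 + (3.43) p.398 + Thm 3.12 p.423 + p.398 (remark after (3.47)); Balaban1984PropagatorsII, Lemma 2.1 (2.60)–(2.61) p.234] -/
theorem GG_input45_of_letters (hG : GeoOK g) (𝔭 : HolderProbes g B X Y PX PY) {𝔬 : Ops g B X Y Z W} {U : B.Cfg}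
    {bHY : ℝ → BlockNorm (toB6 g R₀ H₀) (Y → ℝ)} {bHW : ℝ → BlockNorm (toB6 g R₀ H₀) (W → ℝ)}
    {Bd : ℝ → ℝ} {Bd2 : ℝ → ℝ → ℝ} {θ θH θv B₀ B₃ Bh Bi2 Bq Br β δ₀ δ₃ δK r ρ₄ α Λ σ c ε : ℝ} (hrow : RowSum (toB6 g R₀ H₀) σ c)
    (hc : 0 ≤ c) (hθ : 0 ≤ θ) (hθH : 0 ≤ θH) (hθv : 0 ≤ θv) (hB₀ : 0 ≤ B₀) (hB₃ : 0 ≤ B₃) (hBh : 0 ≤ Bh) (hBi2 : 0 ≤ Bi2)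
    (hBq : 0 ≤ Bq) (hBd2 : 0 ≤ Bd2 ε β) (hBr : 0 ≤ Br) (hΛ : 0 ≤ Λ) (hα : 0 ≤ α) (hσ : 0 ≤ σ) (hε0 : 0 < ε) (hε1 : ε ≤ 1)
    (hβ0 : 0 ≤ β) (hβ1 : β < 1) (hρ₄ : 0 ≤ ρ₄) (hρ₄r : ρ₄ + 3 * σ ≤ (1 - α) * r) (hr : 0 ≤ r) (hr0 : r ≤ δ₀) (hr₃ : r ≤ δ₃)
    (hrK : r + σ ≤ δK) (hq : θ * c < 1) (hST : ScaleTransfer g r α Λ (fun y => g.len y ^ (1 : ℝ)))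
    (hK1 : HasMaj (cNorm R₀ H₀ 𝔬.blk hG.lenle 1) (cNorm R₀ H₀ 𝔬.blk hG.lenle 1) (𝔬.G0 U ∘ₗ (𝔬.Tpi U + 𝔬.T2 U))
      (fun a b => θ * Real.exp (-(δK * g.dist a b))))
    (hK2 : HasMaj (cNorm R₀ H₀ 𝔬.blk hG.lenle 2) (cNorm R₀ H₀ 𝔬.blk hG.lenle 2) (𝔬.G0 U ∘ₗ (𝔬.Tpi U + 𝔬.T2 U))
      (fun a b => θ * Real.exp (-(δK * g.dist a b))))
    (he0 : HasMajorant (g := toB6 g R₀ H₀) 𝔬.blk (𝔬.G0 U) (fun a b => B₀ * g.len a ^ 2 * Real.exp (-(δ₀ * g.dist a b))))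
    (he2 : HasMajorantHom (g := toB6 g R₀ H₀) 𝔬.blkY 𝔬.blk (𝔬.G0 U ∘ₗ 𝔬.Dstar U)
      (fun (a b : g.Site) => B₀ * g.len a * Real.exp (-(δ₀ * g.dist a b))))
    (h43 : HasMajorantHom (g := toB6 g R₀ H₀) 𝔬.blk 𝔭.blkPY (𝔭.ΦY U β ∘ₗ (𝔬.D U ∘ₗ 𝔬.G0 U))
      (fun (a b : g.Site) => Bh * g.len a ^ (1 - β) * Real.exp (-(δ₀ * g.dist a b))))
    (hpY : HasMaj (cNormR R₀ H₀ 𝔬.blk hG.lenle (-2)) (cNormR R₀ H₀ 𝔭.blkPY hG.lenle (β - 1))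
      ((𝔭.ΦY U β ∘ₗ 𝔬.D U ∘ₗ 𝔬.G0 U) ∘ₗ (𝔬.Tpi U + 𝔬.T2 U)) (fun a b => θH * Real.exp (-(δK * g.dist a b))))
    (hpQ : HasMaj (cNormR R₀ H₀ 𝔬.blkZ hG.lenle 0) (cNormR R₀ H₀ 𝔭.blkPY hG.lenle (β - 1))
      ((𝔭.ΦY U β ∘ₗ 𝔬.D U ∘ₗ 𝔬.G0 U) ∘ₗ 𝔬.Qstar U) (fun a b => Bq * Real.exp (-(δ₃ * g.dist a b))))
    (h45 : HasMaj (bHY (β + ε)) (BlockNorm.ofBlocks (toB6 g R₀ H₀) 𝔭.blkPY) (𝔭.ΦY U β ∘ₗ (𝔬.D U ∘ₗ (𝔬.G0 U ∘ₗ 𝔬.Dstar U)))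
      (fun (a b : g.Site) => Bi2 * g.len a ^ (-β) * Real.exp (-(δ₀ * g.dist a b))))
    (htD : HasMaj (bHY (β + ε)) (cNormR R₀ H₀ 𝔬.blk hG.lenle 1) ((𝔬.Tpi U + 𝔬.T2 U) ∘ₗ (𝔬.G0 U ∘ₗ 𝔬.Dstar U))
      (fun a b => θH * Real.exp (-(δK * g.dist a b))))
    (hL : Letters313 𝔬 R₀ H₀ hG B₃ δ₃ U) (hLI : Letters313I 𝔬 𝔭 R₀ H₀ hG.lenle bHY bHW Br θv Bd Bd2 δ₃ δK U) (hI : Identities 𝔬 U) :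
    HasMaj (bHY (β + ε)) (BlockNorm.ofBlocks (toB6 g R₀ H₀) 𝔭.blkPY) (𝔭.ΦY U β ∘ₗ (𝔬.D U ∘ₗ (𝔬.GG U ∘ₗ 𝔬.Dstar U)))
      (fun (a b : g.Site) => constI45 θ θH θv B₀ B₃ Bh Bi2 (Bd2 ε β) Bq Br Λ (bHW (β + ε)).κ c * g.len a ^ (-β) *
        Real.exp (-(ρ₄ * g.dist a b))) := by
  have htri : Triangle254 (toB6 g R₀ H₀) := fun a b c => hG.tri a b c
  have hfix1 := fix_of_inverses hI.invG0' hI.invG1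
  have hfixR := fix_right_of_inverses hI.invG0' hI.invG1
  have hq1 : 0 ≤ (1 - θ * c)⁻¹ := inv_nonneg.mpr (by linarith)
  have hA₁ : 0 ≤ B₀ * (1 - θ * c)⁻¹ := mul_nonneg hB₀ hq1
  have hA₃ : 0 ≤ B₃ * (1 - θ * c)⁻¹ := mul_nonneg hB₃ hq1
  have hCh : 0 ≤ Bh + θH * (B₀ * (1 - θ * c)⁻¹) * c := add_nonneg hBh (mul_nonneg (mul_nonneg hθH hA₁) hc)
  have hKQ' : 0 ≤ Bq + θH * (B₃ * (1 - θ * c)⁻¹) * c := add_nonneg hBq (mul_nonneg (mul_nonneg hθH hA₃) hc)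
  -- rates
  have h1α : (1 - α) * r ≤ r := by rw [sub_mul, one_mul]; exact sub_le_self _ (mul_nonneg hα hr)
  have hρ₂0 : 0 ≤ ρ₄ + 2 * σ := by linarith
  have hρ₂σ : ρ₄ + 2 * σ + σ ≤ (1 - α) * r := by linarith
  have hρ₂α : ρ₄ + 2 * σ ≤ (1 - α) * r := by linarith
  have hρ₂r : ρ₄ + 2 * σ ≤ r := by linarith
  have hρ₂K : ρ₄ + 2 * σ ≤ δK := by linarith
  have hρ₂0' : ρ₄ + 2 * σ ≤ δ₀ := by linarith
  have hρ₂₃ : ρ₄ + 2 * σ ≤ δ₃ := by linarith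
  have hρ₂₃σ : ρ₄ + 2 * σ + σ ≤ δ₃ := by linarith
  set E : (X → ℝ) →ₗ[ℝ] (PY → ℝ) := 𝔭.ΦY U β ∘ₗ 𝔬.D U with hE
  -- the proved probe entry Φ^Y_β∇_UG₁ : 𝔠^{(0)} → 𝔠_P^{(β−1)} at the rate r
  have h43' : HasMajorantHom (g := toB6 g R₀ H₀) 𝔬.blk 𝔭.blkPY (E ∘ₗ 𝔬.G0 U)
      (fun (a b : g.Site) => Bh * g.len a ^ (1 - β) * Real.exp (-(δ₀ * g.dist a b))) := h43
  have hpY' : HasMaj (cNormR R₀ H₀ 𝔬.blk hG.lenle (-2)) (cNormR R₀ H₀ 𝔭.blkPY hG.lenle (β - 1))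
      ((E ∘ₗ 𝔬.G0 U) ∘ₗ (𝔬.Tpi U + 𝔬.T2 U)) (fun a b => θH * Real.exp (-(δK * g.dist a b))) := hpY
  have hA := probe43L_cNormR hG hrow hθ hθH hB₀ hBh hr hr0 hrK hK2 he0 h43' hpY' hfix1 hq
  -- Φ∇G₁∇* from `bHY (β+ε)` and Φ∇G₁D from `bHW (β+ε)` by the right form, into 𝔠_P^{(β)}
  have h45' : HasMaj (bHY (β + ε)) (BlockNorm.ofBlocks (toB6 g R₀ H₀) 𝔭.blkPY) (E ∘ₗ (𝔬.G0 U ∘ₗ 𝔬.Dstar U))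
      (fun (a b : g.Site) => Bi2 * g.len a ^ (-β) * Real.exp (-(δ₀ * g.dist a b))) := h45
  have hGop' := input45_of_step hG hrow hθH hBi2 hCh hΛ hρ₂0 hρ₂σ hρ₂K hρ₂0' hST hA h45' htD hfixR
  have hGop : HasMaj (bHY (β + ε)) (cNormR R₀ H₀ 𝔭.blkPY hG.lenle β) (E ∘ₗ (𝔬.G1 U ∘ₗ 𝔬.Dstar U))
      (fun a b => (Bi2 + (Bh + θH * (B₀ * (1 - θ * c)⁻¹) * c) * Λ * θH * c) * Real.exp (-((ρ₄ + 2 * σ) * g.dist a b))) :=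
    hasMaj_weight_out hG (hGop'.mono fun a b => le_of_eq (by ring))
  have hε' : 0 < β + ε := by linarith
  have hGD' := input45_of_step hG hrow hθv hBd2 hCh hΛ hρ₂0 hρ₂σ hρ₂K hρ₂₃ hST hA (hLI.pdgDv ε β hε0 hε1 hβ0 hβ1)
    (hLI.tDv (β + ε) hε') hfixR
  have hGD : HasMaj (bHW (β + ε)) (cNormR R₀ H₀ 𝔭.blkPY hG.lenle β) (E ∘ₗ (𝔬.G1 U ∘ₗ 𝔬.Dv U))
      (fun a b => (Bd2 ε β + (Bh + θH * (B₀ * (1 - θ * c)⁻¹) * c) * Λ * θv * c) * Real.exp (-((ρ₄ + 2 * σ) * g.dist a b))) :=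
    hasMaj_weight_out hG (hGD'.mono fun a b => le_of_eq (by ring))
  -- Φ∇G₁Q* : Z^{(0)} → 𝔠_P^{(β−1)} by the left form over the real middle class 𝔠^{(−2)}, then (2.60): 𝔠_Z^{(1)} → 𝔠_P^{(β)}
  have hGQr : HasMaj (cNormR R₀ H₀ 𝔬.blkZ hG.lenle 0) (cNormR R₀ H₀ 𝔬.blk hG.lenle (-2)) (𝔬.G1 U ∘ₗ 𝔬.Qstar U)
      (fun a b => B₃ * (1 - θ * c)⁻¹ * Real.exp (-(r * g.dist a b))) := by
    have h := hasMaj_toR hG (hasMaj_right_of_step hG hrow hθ hB₃ hr hr₃ hrK hK2 hL.gQs2 hfix1 hq)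
    simp only [Nat.cast_zero, neg_zero, Nat.cast_ofNat] at h
    exact h
  have hpQ' : HasMaj (cNormR R₀ H₀ 𝔬.blkZ hG.lenle 0) (cNormR R₀ H₀ 𝔭.blkPY hG.lenle (β - 1)) (E ∘ₗ 𝔬.G0 U ∘ₗ 𝔬.Qstar U)
      (fun a b => Bq * Real.exp (-(δ₃ * g.dist a b))) := hpQ
  have hKE : HasMaj (cNormR R₀ H₀ 𝔬.blk hG.lenle (-2)) (cNormR R₀ H₀ 𝔭.blkPY hG.lenle (β - 1))
      (E ∘ₗ 𝔬.G0 U ∘ₗ (𝔬.Tpi U + 𝔬.T2 U)) (fun a b => θH * Real.exp (-(δK * g.dist a b))) := hpY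
  have hDQ := hasMaj_left_rightR hG hrow hθH hBq hA₃ hr hr₃ le_rfl hrK hKE hpQ' hGQr hfix1
  have hDQT := hasMaj_transfer hG hKQ' hST hDQ
  have e1 : (0 : ℝ) + 1 = 1 := by ring
  have e2 : β - 1 + 1 = β := by ring
  rw [e1, e2] at hDQT
  have hGQ : HasMaj (cNormR R₀ H₀ 𝔬.blkZ hG.lenle 1) (cNormR R₀ H₀ 𝔭.blkPY hG.lenle β) (E ∘ₗ 𝔬.G1 U ∘ₗ 𝔬.Qstar U)
      (fun a b => (Bq + θH * (B₃ * (1 - θ * c)⁻¹) * c) * Λ * Real.exp (-((ρ₄ + 2 * σ) * g.dist a b))) :=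
    hDQT.of_rate_le hG.dnn (mul_nonneg hKQ' hΛ) hρ₂α
  -- (3.153) in 𝔠_P^{(β)}, then unweighted
  have h := GG_input_of_pieces hG hrow hc hθ hB₀ hB₃ hBr (add_nonneg hBi2 (mul_nonneg (mul_nonneg (mul_nonneg hCh hΛ) hθH) hc))
    (add_nonneg hBd2 (mul_nonneg (mul_nonneg (mul_nonneg hCh hΛ) hθv) hc)) (mul_nonneg hKQ' hΛ) hσ hρ₄ le_rfl hρ₂r hρ₂₃σ hr hr0 hrK hq
    hK1 he2 hL hI (hLI.domY (β + ε) hε') (hLI.locY (β + ε) hε') (hLI.rgd (β + ε) hε') hGop hGD hGQ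
  have hu := hasMaj_unweight_out hG h
  refine hu.mono fun a b => le_of_eq ?_
  simp only [constI45]
  ring

end OneMember

end

end Literature.MathematicalPhysics.QuantumFieldTheory.Balaban1983to89.B9Thm313WholeInput
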